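import Mathlib

/-!
# From vanishing private readings to periodic prefix sums (§3g STEP 3, plumbing for `rigid_caseA/B`)

Helper for the crux stmt-ValiantsHypothesis-7391 (negative lane; `Cruxes/PeelingLemma/DETERMINISTIC-ALLX.md`
§3h (E4)).  The private letter born at vertex `t₀` of an arm reads the alternating window sum
`Σ_{t=t₀}^{t₀+2q} (-1)^{t-t₀} g t` of the vertex charges (`vsum_apply_private`); in terms of the
alternating prefix sums `P s = Σ_{t=1}^{s} (-1)^t g t` this is `± (P (t₀+2q) - P (t₀-1))`
(`prefix_sub_eq_sum`, `window_sum_eq`), so a vanishing reading is one instance `P (s + (2q+1)) = P s`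
(`periodic_of_window_zero`, `s = t₀ - 1`) of the periodicity hypothesis of
`BinomialElusivePeelingLemmaRigidity.lean`.  Also: `P` is eventually constant when `g` is eventually
zero (`prefix_const_of_zero`), and the mass of `d` on a window is bounded by its total mass
(`mass_window_le`).  Pointwise hypotheses, no windows; no Theses import.
-/

namespace Summit.ValiantsHypothesis.ValiantsHypothesis.Theorems.PeelingLemmaRigidity

-- summit = sub-problem name (single-conjunct summit, D-0017 layout), so the namespace repeats it
set_option linter.dupNamespace false

open scoped BigOperators
open Finset

/-- Telescoping: `P (s+n) - P s = Σ_{t ∈ [s+1, s+n]} (-1)^t g t`. -/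
theorem prefix_sub_eq_sum {P g : ℕ → ℤ} (hPg : ∀ t, 1 ≤ t → P t - P (t - 1) = (-1) ^ t * g t)
    (s n : ℕ) : P (s + n) - P s = ∑ t ∈ Finset.Icc (s + 1) (s + n), (-1) ^ t * g t := by
  induction n with
  | zero => simp
  | succ n ih =>
    rw [show s + (n + 1) = s + n + 1 by ring, Finset.sum_Icc_succ_top (by omega : s + 1 ≤ s + n + 1), ← ih]
    have h := hPg (s + n + 1) (by omega)
    rw [Nat.add_sub_cancel] at h
    linarith

/-- The window sum with the letter's own sign convention: `Σ_{t ∈ [t₀, t₀+m]} (-1)^t g t =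
(-1)^{t₀} Σ_{t ∈ [t₀, t₀+m]} (-1)^{t-t₀} g t`. -/
theorem window_sum_eq (g : ℕ → ℤ) (t₀ m : ℕ) :
    ∑ t ∈ Finset.Icc t₀ (t₀ + m), (-1) ^ t * g t =
      (-1) ^ t₀ * ∑ t ∈ Finset.Icc t₀ (t₀ + m), (-1) ^ (t - t₀) * g t := by
  rw [Finset.mul_sum]
  refine Finset.sum_congr rfl fun t ht => ?_
  have h := (Finset.mem_Icc.mp ht).1
  rw [← mul_assoc, ← pow_add, show t₀ + (t - t₀) = t by omega]

/-- **Vanishing reading ⇒ one period.**  If the private letter born at `s+1` reads zero, i.e.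
`Σ_{t ∈ [s+1, s+1+2q]} (-1)^{t-(s+1)} g t = 0`, then `P (s + (2q+1)) = P s`. -/
theorem periodic_of_window_zero {P g : ℕ → ℤ} (hPg : ∀ t, 1 ≤ t → P t - P (t - 1) = (-1) ^ t * g t)
    (q s : ℕ) (hwin : ∑ t ∈ Finset.Icc (s + 1) (s + 1 + 2 * q), (-1) ^ (t - (s + 1)) * g t = 0) :
    P (s + (2 * q + 1)) = P s := by
  have h := prefix_sub_eq_sum hPg s (2 * q + 1)
  rw [show s + (2 * q + 1) = s + 1 + 2 * q by ring] at h ⊢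
  rw [window_sum_eq g (s + 1) (2 * q), hwin, mul_zero] at h
  linarith

/-- `P` is constant from `M` on if `g` vanishes beyond `M`. -/
theorem prefix_const_of_zero {P g : ℕ → ℤ} (hPg : ∀ t, 1 ≤ t → P t - P (t - 1) = (-1) ^ t * g t)
    {M : ℕ} (hg : ∀ t, M < t → g t = 0) (s : ℕ) (hs : M ≤ s) : P s = P M := by
  induction s, hs using Nat.le_induction with
  | base => rfl
  | succ s hs ih =>
    have h := hPg (s + 1) (by omega)
    rw [Nat.add_sub_cancel, hg (s + 1) (by omega), mul_zero] at h
    linarith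

/-- If `d` vanishes beyond `M` then so does `g t = d t - d (t-1)` beyond `M+1`… stated pointwise:
`d t = 0` and `d (t-1) = 0` give `g t = 0`. -/
theorem charge_zero_of_flat {d g : ℕ → ℤ} (hdg : ∀ t, 1 ≤ t → d t - d (t - 1) = g t) {t : ℕ}
    (ht : 1 ≤ t) (h1 : d t = 0) (h0 : d (t - 1) = 0) : g t = 0 := by
  have := hdg t ht; rw [h1, h0, sub_zero] at this; exact this.symm

/-- Mass on a window is at most the total mass (nonnegative terms). -/
theorem mass_window_le (d : ℕ → ℤ) {a q L : ℕ} (h : a + 2 * q ≤ L) :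
    ∑ t ∈ Finset.Ico a (a + 2 * q), |d t| ≤ ∑ t ∈ Finset.range L, |d t| := by
  refine Finset.sum_le_sum_of_subset_of_nonneg ?_ fun t _ _ => abs_nonneg _
  intro t ht
  rw [Finset.mem_Ico] at ht
  exact Finset.mem_range.mpr (by omega)

/-- The `Finset.filter` form of a window inside `range L` is the interval, when it fits. -/
theorem filter_window_eq_Icc {L t₀ q : ℕ} (h : t₀ + 2 * q < L) :
    (Finset.range L).filter (fun t => t₀ ≤ t ∧ t ≤ t₀ + 2 * q) = Finset.Icc t₀ (t₀ + 2 * q) := by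
  ext t
  simp only [Finset.mem_filter, Finset.mem_range, Finset.mem_Icc]
  omega

end Summit.ValiantsHypothesis.ValiantsHypothesis.Theorems.PeelingLemmaRigidity
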